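import Summits.QuantumFields.YangMills.Theses.StretchedTail

/-!
# Crux `HistoryTailL` (stmt-QuantumFields-19936) — LINE «stretched-tail» (ideator seat ym-r3-idea-2 g4, lens «nearmiss»)

The line IS route `StretchedTail` (route-QuantumFields-StretchedTail, DRAFT, tribunal pending; critic idea-crit-5 to vet): its crux `OrliczTailL`
(rank 2) split into the two REGIME STUBS of its birth skeleton (fine half `2j ≤ K`, deep half `K < 2j`, monotone closure so the
join `OrliczTailL_of` is pure logic), plus the glue item `HistoryTailOfOrlicz` (support r9, provable now) BY NAME, give
`UnitScaleTilt.HistoryTailL` BY NAME.  Sorries ONLY inside `stub_*`.  No summit, no rung (`YM3TorusSU2`), no mass gap is proved;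
`HistoryTailL` stays open behind the stubs.
-/

namespace Summit.QuantumFields.YangMills.Cruxes.HistoryTailL.StretchedTail

open scoped BigOperators Topology Classical MeasureTheory ProbabilityTheory Matrix
open Filter Set Function TopologicalSpace MeasureTheory
open Summit.QuantumFields.YangMills.Theses.StretchedTail (OrliczTailL HistoryTailOfOrlicz)

/-! ## §1 The registered stubs (the ONLY sorries) -/

/-- stub (M, = item `HistoryTailOfOrlicz`, support r9 of route `StretchedTail`: Chernoff/Chebyshev + the landed union-bound schema). -/
theorem stub_historyTailOfOrlicz : HistoryTailOfOrlicz := by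
  sorry

/-- STUB 1 (fine half, heights `K − j ≥ j`): ψ_α bound at the running scale, monotone closure in (α, C, A).
Expected technique: capped quadratic tilt / sub-Gaussian MGF at scale g_(K−j) (few integrated scales; the regime where
CoarseStiffnessTail / SmallFieldWidening live), then ψ₂ ⇒ ψ_α for every α ≤ 2. -/
theorem stub_fineOrlicz : open Literature.MathematicalPhysics.QuantumFieldTheory.Balaban1983to89 Literature.MathematicalPhysics.QuantumFieldTheory.Balaban1983to89.T3ContinuumYM3Torus in ∀ (L : ℕ), ∃ α₀ : ℝ, 0 < α₀ ∧ ∀ (α : ℝ), 0 < α → α ≤ α₀ → ∃ γ₁ : ℝ, 0 < γ₁ ∧ γ₁ ≤ 1 ∧ ∀ (F : T3Family) (γ : ℝ), F.L = L → 0 < γ → γ ≤ γ₁ → ∃ C₀ : ℝ, 0 < C₀ ∧ ∀ (C : ℝ), C₀ ≤ C → ∃ A₀ : ℕ, ∀ (A : ℕ), A₀ ≤ A → ∃ D : ℝ, 0 ≤ D ∧ ∀ (K j : ℕ), 1 ≤ j → j ≤ K → 2 * j ≤ K → ∀ (p : Plaq (F.P K) j), Integrable (fun U => Real.exp ((GaugeGroup.dist1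 (GaugeField.plaqHol (Averaging.iter (fun i => BlockAveraging.blockAvg (P := F.P K) (j := i) T3UnitLawDensityEML.ℰp) j U) p) / (C * Real.sqrt (γ * ((F.L : ℝ)⁻¹) ^ (K - j)))) ^ α)) (T3UnitScaleTilt.gibbsK F T3UnitLawDensityEML.ℰp γ K) ∧ ∫ U, Real.exp ((GaugeGroup.dist1 (GaugeField.plaqHol (Averaging.iter (fun i => BlockAveraging.blockAvg (P := F.P K) (j := i) T3UnitLawDensityEML.ℰp) j U) p) / (C * Real.sqrt (γ * ((F.L : ℝ)⁻¹) ^ (K - j)))) ^ α) ∂(T3UnitScaleTilt.gibbsK F T3UnitLawDensityEML.ℰp γ K) ≤ D * (F.scheme T3UnitLawDensityEML.ℰp γ).β (K - j) ^ A := by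
  sorry

/-- STUB 2 (deep half, heights `K − j < j`): ψ_α bound for SOME α(L) ∈ (0, 1] from exponential-moment (n!·Cⁿ cumulant)
bounds of the height-j effective theory with a source coupled to the coarse plaquette — the load-bearing stub. -/
theorem stub_deepOrlicz : open Literature.MathematicalPhysics.QuantumFieldTheory.Balaban1983to89 Literature.MathematicalPhysics.QuantumFieldTheory.Balaban1983to89.T3ContinuumYM3Torus in ∀ (L : ℕ), ∃ α₀ : ℝ, 0 < α₀ ∧ ∀ (α : ℝ), 0 < α → α ≤ α₀ → ∃ γ₁ : ℝ, 0 < γ₁ ∧ γ₁ ≤ 1 ∧ ∀ (F : T3Family) (γ : ℝ), F.L = L → 0 < γ → γ ≤ γ₁ → ∃ C₀ : ℝ, 0 < C₀ ∧ ∀ (C : ℝ), C₀ ≤ C → ∃ A₀ : ℕ, ∀ (A : ℕ), A₀ ≤ A → ∃ D : ℝ, 0 ≤ D ∧ ∀ (K j : ℕ), 1 ≤ j → j ≤ K → K < 2 * j → ∀ (p : Plaq (F.P K) j), Integrable (fun U => Real.exp ((GaugeGroup.dist1 (GaugeField.plaqHol (Averaging.iter (fun i => BlockAveraging.blockAvg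 (P := F.P K) (j := i) T3UnitLawDensityEML.ℰp) j U) p) / (C * Real.sqrt (γ * ((F.L : ℝ)⁻¹) ^ (K - j)))) ^ α)) (T3UnitScaleTilt.gibbsK F T3UnitLawDensityEML.ℰp γ K) ∧ ∫ U, Real.exp ((GaugeGroup.dist1 (GaugeField.plaqHol (Averaging.iter (fun i => BlockAveraging.blockAvg (P := F.P K) (j := i) T3UnitLawDensityEML.ℰp) j U) p) / (C * Real.sqrt (γ * ((F.L : ℝ)⁻¹) ^ (K - j)))) ^ α) ∂(T3UnitScaleTilt.gibbsK F T3UnitLawDensityEML.ℰp γ K) ≤ D * (F.scheme T3UnitLawDensityEML.ℰp γ).β (K - j) ^ A := by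
  sorry

/-! ## §2 The crux of the route and the crux of `UnitScaleTilt` BY NAME — no sorry below this line -/

/-- COMPOSITION (kernel-checked, no sorry): the two regime stubs give the route crux BY NAME. -/
theorem OrliczTailL_of (h₁ : open Literature.MathematicalPhysics.QuantumFieldTheory.Balaban1983to89 Literature.MathematicalPhysics.QuantumFieldTheory.Balaban1983to89.T3ContinuumYM3Torus in ∀ (L : ℕ), ∃ α₀ : ℝ, 0 < α₀ ∧ ∀ (α : ℝ), 0 < α → α ≤ α₀ → ∃ γ₁ : ℝ, 0 < γ₁ ∧ γ₁ ≤ 1 ∧ ∀ (F : T3Family) (γ : ℝ), F.L = L → 0 < γ → γ ≤ γ₁ → ∃ C₀ : ℝ, 0 < C₀ ∧ ∀ (C : ℝ), C₀ ≤ C → ∃ A₀ : ℕ, ∀ (A : ℕ), A₀ ≤ A → ∃ D : ℝ, 0 ≤ D ∧ ∀ (K j : ℕ), 1 ≤ j → j ≤ K → 2 * j ≤ K → ∀ (p : Plaq (F.P K) j), Integrable (fun U => Real.exp ((GaugeGroup.dist1 (GaugeField.plaqHol (Averaging.iter (fun i => BlockAveraging.blockAvg (P := F.P K) (j := i) T3UnitLawDensityEML.ℰp)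 j U) p) / (C * Real.sqrt (γ * ((F.L : ℝ)⁻¹) ^ (K - j)))) ^ α)) (T3UnitScaleTilt.gibbsK F T3UnitLawDensityEML.ℰp γ K) ∧ ∫ U, Real.exp ((GaugeGroup.dist1 (GaugeField.plaqHol (Averaging.iter (fun i => BlockAveraging.blockAvg (P := F.P K) (j := i) T3UnitLawDensityEML.ℰp) j U) p) / (C * Real.sqrt (γ * ((F.L : ℝ)⁻¹) ^ (K - j)))) ^ α) ∂(T3UnitScaleTilt.gibbsK F T3UnitLawDensityEML.ℰp γ K) ≤ D * (F.scheme T3UnitLawDensityEML.ℰp γ).β (K - j) ^ A) (h₂ : open Literature.MathematicalPhysics.QuantumFieldTheory.Balaban1983to89 Literature.MathematicalPhysics.QuantumFieldTheory.Balaban1983to89.T3ContinuumYM3Torus in ∀ (L : ℕ), ∃ α₀ : ℝ, 0 < α₀ ∧ ∀ (α : ℝ), 0 < α → α ≤ α₀ → ∃ γ₁ : ℝ, 0 < γ₁ ∧ γ₁ ≤ 1 ∧ ∀ (F : T3Family) (γ : ℝ), F.L = L → 0 < γ → γ ≤ γ₁ → ∃ C₀ : ℝ, 0 < C₀ ∧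 ∀ (C : ℝ), C₀ ≤ C → ∃ A₀ : ℕ, ∀ (A : ℕ), A₀ ≤ A → ∃ D : ℝ, 0 ≤ D ∧ ∀ (K j : ℕ), 1 ≤ j → j ≤ K → K < 2 * j → ∀ (p : Plaq (F.P K) j), Integrable (fun U => Real.exp ((GaugeGroup.dist1 (GaugeField.plaqHol (Averaging.iter (fun i => BlockAveraging.blockAvg (P := F.P K) (j := i) T3UnitLawDensityEML.ℰp) j U) p) / (C * Real.sqrt (γ * ((F.L : ℝ)⁻¹) ^ (K - j)))) ^ α)) (T3UnitScaleTilt.gibbsK F T3UnitLawDensityEML.ℰp γ K) ∧ ∫ U, Real.exp ((GaugeGroup.dist1 (GaugeField.plaqHol (Averaging.iter (fun i => BlockAveraging.blockAvg (P := F.P K) (j := i) T3UnitLawDensityEML.ℰp) j U) p) / (C * Real.sqrt (γ * ((F.L : ℝ)⁻¹) ^ (K - j)))) ^ α) ∂(T3UnitScaleTilt.gibbsK F T3UnitLawDensityEML.ℰp γ K) ≤ D * (F.scheme T3UnitLawDensityEML.ℰp γ).β (K - j) ^ A) : OrliczTailL := by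
  intro L
  obtain ⟨α₁, hα₁, H₁⟩ := h₁ L
  obtain ⟨α₂, hα₂, H₂⟩ := h₂ L
  have hα : 0 < min α₁ α₂ := lt_min hα₁ hα₂
  obtain ⟨γ₁, hγ₁, hγ₁1, G₁⟩ := H₁ (min α₁ α₂) hα (min_le_left _ _)
  obtain ⟨γ₂, hγ₂, hγ₂1, G₂⟩ := H₂ (min α₁ α₂) hα (min_le_right _ _)
  refine ⟨min α₁ α₂, hα, min γ₁ γ₂, lt_min hγ₁ hγ₂, (min_le_left _ _).trans hγ₁1, ?_⟩
  intro F γ hF hγ hγle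
  obtain ⟨C₁, hC₁, K₁⟩ := G₁ F γ hF hγ (hγle.trans (min_le_left _ _))
  obtain ⟨C₂, hC₂, K₂⟩ := G₂ F γ hF hγ (hγle.trans (min_le_right _ _))
  obtain ⟨A₁, M₁⟩ := K₁ (max C₁ C₂) (le_max_left _ _)
  obtain ⟨A₂, M₂⟩ := K₂ (max C₁ C₂) (le_max_right _ _)
  obtain ⟨D₁, hD₁, B₁⟩ := M₁ (max A₁ A₂) (le_max_left _ _)
  obtain ⟨D₂, hD₂, B₂⟩ := M₂ (max A₁ A₂) (le_max_right _ _)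
  refine ⟨max C₁ C₂, max D₁ D₂, max A₁ A₂, lt_max_of_lt_left hC₁, le_max_of_le_left hD₁, ?_⟩
  intro K j hj hjK p
  have hβ : 0 ≤ (F.scheme Literature.MathematicalPhysics.QuantumFieldTheory.Balaban1983to89.T3UnitLawDensityEML.ℰp γ).β (K - j) ^ max A₁ A₂ :=
    pow_nonneg (F.scheme_β_nonneg _ hγ.le _) _
  by_cases hreg : 2 * j ≤ K
  · obtain ⟨hint, hle⟩ := B₁ K j hj hjK hreg p
    exact ⟨hint, hle.trans (mul_le_mul_of_nonneg_right (le_max_left _ _) hβ)⟩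
  · obtain ⟨hint, hle⟩ := B₂ K j hj hjK (Nat.lt_of_not_le hreg) p
    exact ⟨hint, hle.trans (mul_le_mul_of_nonneg_right (le_max_right _ _) hβ)⟩


/-- `UnitScaleTilt.HistoryTailL` BY NAME from the three stubs (the glue item applied to the joined regime stubs). -/
theorem HistoryTailL_of : Summit.QuantumFields.YangMills.Theses.UnitScaleTilt.HistoryTailL :=
  stub_historyTailOfOrlicz (OrliczTailL_of stub_fineOrlicz stub_deepOrlicz)

end Summit.QuantumFields.YangMills.Cruxes.HistoryTailL.StretchedTail
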